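import Literature.NumberTheory.EllipticCurves.BigRepModuleShapiroInjectiveProofs
import Mathlib.NumberTheory.Padics.RingHoms
import HarnessLib

/-!
# Shapiro's map for the co-induced module `M = A ⊗ Λ^*(Ψ⁻¹)`: conjugates of the Shapiro image are
# evaluations at other points, and the LOCAL criterion at a subgroup on which `κ` vanishes — PROVED

Topic `Literature/NumberTheory/EllipticCurves`. Theorems only: no definition, no named fact, no
`sorry`, no instance, no notation. Cell `bsd-stepL`, seat `bsd-stepL-imc-p1` (g11): module M3a of the
tree-mapped discharge plan `NOTE-prop323-Shapiro-discharge-plan-imc-p1-g11` for the named fact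
`SkinnerUrban2014.prop323_XAc_equiv_XBigDecomp` ([SU14] Prop. 3.2.3), the part of the LOCAL-CONDITIONS
comparison (SU14 §3.1.2, (3.1.2.a)–(3.1.2.b)) that is pure group cohomology:

* **`conj_apply_zero_eq_apply`** — for a 1-cocycle `c` of `bigRep κ ρ`, ANY `σ ∈ G` and `δ ∈ ker κ`:
  `ρ(σ)·c(σ⁻¹ δ σ)(0) = c(δ)(κ σ) + (ρ(δ) b − b)`, `b = c(σ)(κ σ)`. The conjugate `conj_σ (Sh c)` of the
  Shapiro image is, up to a coboundary, the EVALUATION of `c` AT `κ σ` (restricted to `ker κ`). This is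
  why Castella's / Greenberg's Selmer condition over `K_∞` "at all places above `v`" (all `Γ_K`-conjugates
  of the chosen decomposition group intersected with `ker κ`) matches "all evaluations `x ∈ ℤ_p`" of the
  big cocycle on the decomposition group. (`σ = γ̃`, `κ γ̃ = 1` is the orientation lemma
  `conj_apply_zero_eq` of `BigRepModuleShapiroEquivariantProofs.lean`.)
* **`exists_eq_bigRep_sub_iff_forall_apply`** — LOCAL SHAPIRO at a compact subgroup `D ≤ G` on which `κ`
  is trivial (a place splitting completely in the `ℤ_p`-extension, e.g. every prime of `K` inert in
  `K/ℚ` for the anticyclotomic tower): a continuous cocycle `c : D → M` of `bigRep κ ρ|_D` (which acts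
  through `ρ` pointwise) is a coboundary IFF every evaluation `δ ↦ c(δ)(x)` is a coboundary of `ρ|_D` on
  `A` — the smooth choice of primitives uses a common level of the finitely many values of `c` and the
  representatives `x ↦ (x mod pⁿ)` (`PadicInt.toZModPow`).
Not here (M3b): the finitely decomposed places (`κ(D) = p^e ℤ_p ≠ 0`: Shapiro for `(D, D ∩ ker κ)` via
M1/M2 after rescaling), and the dictionary with the tree's `selmerAc` / `selmerBigDecomp` predicates.

HONEST FRAMING: cocycle identities for an induced module; nothing about elliptic curves or BSD; the named
fact `prop323_…` is NOT discharged by this file.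

References: [SkinnerUrban2014] §3.1.2 ((3.1.2.a), (3.1.2.b)) and Prop. 3.2.3; [SerreGaloisCohomology1997]
I §2.5; [GreenbergLNM1716] §1 (primes splitting completely in `K_∞`). Tree: `AnticyclotomicBigGaloisRep.lean`,
`BigRepModuleShapiroInjectiveProofs.lean` (M1: `exists_uniform_pow_smul_eq_zero`).
-/

noncomputable section

open Multiplicative Topology
open Literature.NumberTheory.GaloisRepresentations

namespace Literature.NumberTheory.EllipticCurves.BigRepModule

universe u

variable {𝒪 : Type*} [CommRing 𝒪] {p : ℕ} [hp : Fact p.Prime] {A : Type u} [AddCommGroup A] [Module 𝒪 A]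
  [TopologicalSpace 𝒪] [TopologicalSpace A] [DiscreteTopology A]
  {G : Type u} [Group G] [TopologicalSpace G] [IsTopologicalGroup G] [TopologicalSpace (PowerSeries 𝒪)]
  {κ : G →ₜ* Multiplicative ℤ_[p]} {ρ : ContinuousRep G 𝒪 A}

/-! ## §1 Conjugating the Shapiro image = evaluating elsewhere -/

/-- **`conj_σ (Sh c) = ev_{κ σ} ∘ c` up to a coboundary on `ker κ`.** For a 1-cocycle `c` of `bigRep κ ρ`,
any `σ ∈ G` and `δ` with `κ δ = 1`: `ρ(σ)(c(σ⁻¹ δ σ)(0)) = c(δ)(κ σ) + (ρ(δ) b − b)` with `b = c(σ)(κ σ)`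
(the two expansions of `c(δσ) = c(σ · σ⁻¹δσ)` read at `x = κ σ`).
[cite: SkinnerUrban2014, §3.1.2 ((3.1.2.a)–(3.1.2.b): compatibility of Shapiro's isomorphism with restriction to the places `w ∣ v`)] -/
theorem conj_apply_zero_eq_apply {c : G → BigRepModule 𝒪 p A}
    (hc : ∀ g h : G, c (g * h) = c g + bigRep κ ρ g (c h)) (σ : G) {δ : G} (hδ : κ δ = 1) :
    ρ σ (c (σ⁻¹ * δ * σ) 0) =
      c δ (κ σ).toAdd + (ρ δ (c σ (κ σ).toAdd) - c σ (κ σ).toAdd) := by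
  have h1 : c (δ * σ) = c δ + bigRep κ ρ δ (c σ) := hc δ σ
  have h2 : c (δ * σ) = c σ + bigRep κ ρ σ (c (σ⁻¹ * δ * σ)) := by
    have e : σ * (σ⁻¹ * δ * σ) = δ * σ := by group
    rw [← e]
    exact hc σ (σ⁻¹ * δ * σ)
  have key := congrArg (fun Ψ : BigRepModule 𝒪 p A ↦ Ψ (κ σ).toAdd) (h1.symm.trans h2)
  simp only [BigRepModule.add_apply, bigRep_apply_apply, hδ, toAdd_one, sub_zero, sub_self] at key
  -- `key : c δ (κ σ) + ρ δ (c σ (κ σ)) = c σ (κ σ) + ρ σ (c (σ⁻¹ δ σ) 0)`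
  rw [← add_sub_assoc, key, add_sub_cancel_left]

/-! ## §2 Local Shapiro where `κ` vanishes: coboundary iff every evaluation is a coboundary -/

omit [TopologicalSpace 𝒪] [TopologicalSpace A] [DiscreteTopology A] [Group G] [TopologicalSpace G]
  [IsTopologicalGroup G] [TopologicalSpace (PowerSeries 𝒪)] in
/-- A finite family of smooth functions has a common level. [cite: SkinnerUrban2014, §3.1.1 (`Λ^* = lim→ Maps(Γ/Γ^{pⁿ}, ·)`)] -/
theorem exists_common_level {X : Type*} {c : X → BigRepModule 𝒪 p A} (hfin : (Set.range c).Finite) :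
    ∃ n : ℕ, ∀ (x : X) (y z : ℤ_[p]), y - z ∈ Ideal.span {(p : ℤ_[p]) ^ n} → c x y = c x z := by
  classical
  have hval : ∀ Φ ∈ hfin.toFinset, ∃ n : ℕ, IsSmoothOfLevel p A n Φ := fun Φ _ ↦ Φ.exists_level
  choose! lv hlv using hval
  refine ⟨hfin.toFinset.sup lv, fun x y z hyz ↦ ?_⟩
  have hx : c x ∈ hfin.toFinset := (Set.Finite.mem_toFinset hfin).2 ⟨x, rfl⟩
  refine hlv _ hx y z (Ideal.span_singleton_le_span_singleton.2
    (pow_dvd_pow _ (Finset.le_sup (f := lv) hx)) hyz)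

/-- **LOCAL SHAPIRO AT A SUBGROUP WHERE `κ` VANISHES.** Let `D ≤ G` be a subgroup, compact in the subspace
topology, with `κ(D) = 1` (so `D` acts on `M` pointwise through `ρ`: `(δ·Φ)(x) = ρ(δ)Φ(x)`), `A`
`p`-primary and discrete, and `c : D → M` a continuous 1-cocycle of `bigRep κ ρ|_D`. Then `c` is a
coboundary (`∃ Φ, c(δ) = δ·Φ − Φ`) IFF for every `x ∈ ℤ_p` the evaluation `δ ↦ c(δ)(x)` is a coboundary
of `ρ|_D` (`∃ a, c(δ)(x) = ρ(δ)a − a`). (⟸: primitives chosen along the finitely many residues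
`x mod pⁿ`, `n` a common level of the finitely many values of `c`, give a SMOOTH `Φ`.)
[cite: SkinnerUrban2014, §3.1.2 ((3.1.2.b), the places splitting completely)] [cite: GreenbergLNM1716, §1] -/
theorem exists_eq_bigRep_sub_iff_forall_apply (hA : ∀ a : A, ∃ k : ℕ, p ^ k • a = 0)
    {D : Subgroup G} [CompactSpace D] (hD : ∀ δ : D, κ (δ : G) = 1)
    {c : D → BigRepModule 𝒪 p A} (hcont : Continuous c) :
    (∃ Φ : BigRepModule 𝒪 p A, ∀ δ : D, c δ = bigRep κ ρ (δ : G) Φ - Φ) ↔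
      ∀ x : ℤ_[p], ∃ a : A, ∀ δ : D, c δ x = ρ (δ : G) a - a := by
  classical
  constructor
  · rintro ⟨Φ, hΦ⟩ x
    refine ⟨Φ x, fun δ ↦ ?_⟩
    rw [hΦ δ, BigRepModule.sub_apply, bigRep_apply_apply, hD δ, toAdd_one, sub_zero]
  · intro h
    choose a ha using h
    -- a common level `n` of the finitely many values of `c`
    obtain ⟨n, hn⟩ := exists_common_level (((IsLocallyConstant.iff_continuous c).2 hcont).range_finite)
    -- representatives `r x = (x mod pⁿ)` read back in `ℤ_p`
    haveI : NeZero (p ^ n) := ⟨pow_ne_zero n hp.out.ne_zero⟩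
    set r : ℤ_[p] → ℤ_[p] := fun x ↦ ((PadicInt.toZModPow n x).val : ℤ_[p]) with hr
    have hrx : ∀ x : ℤ_[p], x - r x ∈ Ideal.span {(p : ℤ_[p]) ^ n} := by
      intro x
      rw [← PadicInt.ker_toZModPow, RingHom.mem_ker, map_sub, map_natCast, ZMod.natCast_zmod_val,
        sub_self]
    have hrr : ∀ x y : ℤ_[p], x - y ∈ Ideal.span {(p : ℤ_[p]) ^ n} → r x = r y := by
      intro x y hxy
      have : PadicInt.toZModPow n x = PadicInt.toZModPow n y := by
        rw [← sub_eq_zero, ← map_sub, ← RingHom.mem_ker, PadicInt.ker_toZModPow]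
        exact hxy
      simp only [hr, this]
    -- the smooth primitive `Φ x := a (r x)`
    set Φf : ℤ_[p] → A := fun x ↦ a (r x) with hΦf
    have hsmooth : IsSmoothOfLevel p A n Φf := fun x y hxy ↦ by
      simp only [hΦf, hrr x y hxy]
    have hfin : (Set.range Φf).Finite := by
      refine (Set.finite_range (fun t : ZMod (p ^ n) ↦ a ((t.val : ℕ) : ℤ_[p]))).subset ?_
      rintro _ ⟨x, rfl⟩
      exact ⟨PadicInt.toZModPow n x, rfl⟩
    obtain ⟨k, hk⟩ := exists_uniform_pow_smul_eq_zero (p := p) hfin (fun x ↦ hA (Φf x))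
    refine ⟨BigRepModule.mk Φf ⟨⟨n, hsmooth⟩, ⟨k, hk⟩⟩, fun δ ↦ BigRepModule.ext fun x ↦ ?_⟩
    rw [BigRepModule.sub_apply, bigRep_apply_apply, hD δ, toAdd_one, sub_zero]
    change c δ x = ρ (δ : G) (a (r x)) - a (r x)
    rw [hn δ x (r x) (hrx x)]
    exact ha (r x) δ

end Literature.NumberTheory.EllipticCurves.BigRepModule

end
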